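import Literature.Computability.Complexity.KannanLanguage
import Literature.Computability.Complexity.IterateFPGrowth
import HarnessLib

/-!
# Unary offsets: products of lengths and zero-padded windows of a string at a unary position

Trunk `CplxCore`, toolkit continuing `CoinTruncation.lean` (`truncSndFn`, `dropSndFn`),
`CookReducibilityTransitive.lean` (`concatFn`, `padFn`, projections `fstP`/`sndP`, `pairFn`),
`KannanLanguage.lean` (`Kannan.zerosFn`, the bit reader `Kannan.bitFn`) and `IterateFPGrowth.lean`
(`iterate_mem_FP_of_sq`). Random access into a string by a machine of the tree's `FP` algebra is
done with *unary* offsets — a string `o` stands for the number `|o|` — and this file supplies the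
two missing pieces for addressing the blocks `v[k·B + j·b, k·B + j·b + b)` of quantified strings (the
matrix of Sipser's `Hash` predicate, Han–Hemaspaandra–Thierauf 1997, Def. 3.8; single bits are read
with `Kannan.bitFn`):

* `mulLenFn` — **`⟨a, b⟩ ↦` a string of length `|a|·|b|`** (`length_mulLenFn`; `|a|` clocked
  rounds of "append `b`", `iterate_mem_FP_of_sq`): products of unary quantities; sums are
  `concatFn`;
* `zerosPadFn q` — `z ↦ 0^{q(|z.1|)}` (`Kannan.zerosFn ∘ padFn q`);
* `windowFn q` — **`⟨⟨s, o⟩, x⟩ ↦ (s ⇂ |o| ++ 0^{q|x|}) ↾ q|x|`**, the zero-padded window of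
  length `q(|x|)` of `s` at offset `|o|` (`windowFn_apply`); as a list of bits it is
  `List.ofFn (c ↦ s.getD (|o| + c) false)` (`window_eq_ofFn`), so windows of a too-short string
  are read with default `0` — the reading under which every string decodes to a tuple of
  fixed-length blocks, and the same default as the bit test `Kannan.head?_drop_eq_some_true_iff`.

## References

* S. Arora, B. Barak, *Computational Complexity: A Modern Approach*, CUP 2009, §1.3 (polynomial
  time is robust: counters, copying, addressing), §1.4.1 (clocked loops).
* Y. Han, L. A. Hemaspaandra, T. Thierauf, *Threshold computation and cryptographic security*,
  SIAM J. Comput. 26 (1997), Def. 3.8 (the predicate whose matrix these maps address).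
-/

namespace Literature.Computability.Complexity

open _root_.Computability Polynomial PRelSigma OracleCompose

namespace UnaryOffsets

/-! ### Products of lengths -/

/-- One round of the multiplier: `⟨a, ⟨b, acc⟩⟩ ↦ ⟨a, ⟨b, b ++ acc⟩⟩` (on arbitrary strings:
re-pair the projections). [folklore] -/
noncomputable def mulRound : List Bool → List Bool :=
  pairFn fstP (pairFn (fstP ∘ sndP) (concatFn ∘ sndP))

/-- `mulRound ∈ FP`. [folklore] -/
theorem mulRound_mem_FP : mulRound ∈ FP :=
  pairFn_mem_FP fstP_mem_FP (pairFn_mem_FP (comp_mem_FP fstP_mem_FP sndP_mem_FP)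
    (comp_mem_FP concatFn_mem_FP sndP_mem_FP))

/-- `mulRound` on a well-formed state. [folklore] -/
theorem mulRound_boolPair (a b acc : List Bool) :
    mulRound (boolPair a (boolPair b acc)) = boolPair a (boolPair b (b ++ acc)) := by
  simp [mulRound, concatFn, concatT_eval_boolPair]

/-- `mulRound` on an arbitrary string produces a well-formed state. [folklore] -/
theorem mulRound_apply (z : List Bool) :
    mulRound z = boolPair (fstP z) (boolPair (fstP (sndP z)) (concatFn (sndP z))) := by
  simp [mulRound]

/-- `n` copies of `b` in front of `acc`. [folklore] -/
def repApp (b : List Bool) (n : ℕ) (acc : List Bool) : List Bool := (List.replicate n b).flatten ++ acc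

/-- Length of `repApp`. [folklore] -/
@[simp] theorem length_repApp (b : List Bool) (n : ℕ) (acc : List Bool) :
    (repApp b n acc).length = n * b.length + acc.length := by
  simp [repApp, List.length_flatten]

/-- Iterating `mulRound` on a well-formed state. [folklore] -/
theorem iterate_mulRound_boolPair (a b acc : List Bool) (n : ℕ) :
    mulRound^[n] (boolPair a (boolPair b acc)) = boolPair a (boolPair b (repApp b n acc)) := by
  induction n with
  | zero => simp [repApp]
  | succ n ih =>
    rw [Function.iterate_succ_apply', ih, mulRound_boolPair]
    simp [repApp, List.replicate_succ]

/-- Iterating `mulRound` on an arbitrary string: one round normalises, the rest append. [folklore] -/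
theorem iterate_mulRound_succ (z : List Bool) (n : ℕ) :
    mulRound^[n + 1] z =
      boolPair (fstP z) (boolPair (fstP (sndP z)) (repApp (fstP (sndP z)) n (concatFn (sndP z)))) := by
  rw [Function.iterate_succ_apply, mulRound_apply, iterate_mulRound_boolPair]

/-- **Quadratic size bound for the iterates of `mulRound`.** [folklore] -/
theorem length_iterate_mulRound_le (z : List Bool) (n : ℕ) :
    (mulRound^[n] z).length ≤ 4 * (z.length + n + 1) ^ 2 := by
  rcases n with _ | n
  · simp only [Function.iterate_zero, id_eq]
    nlinarith
  rw [iterate_mulRound_succ, length_boolPair, length_boolPair, length_repApp]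
  have ha : 2 * (fstP z).length ≤ z.length := two_mul_length_boolUnpair_fst_le z
  have hs : (sndP z).length ≤ z.length := length_boolUnpair_snd_le_length z
  have hb : (fstP (sndP z)).length ≤ z.length :=
    (length_boolUnpair_fst_le _).trans hs
  have hc : (concatFn (sndP z)).length ≤ z.length := (length_concatFn_le _).trans hs
  have hnb : n * (fstP (sndP z)).length ≤ n * z.length := Nat.mul_le_mul_left n hb
  nlinarith

/-- **The length multiplier** `mulLenFn ⟨a, b⟩`: a string of length `|a|·|b|` (namely `b^{|a|}`),
computed by `|a|` clocked rounds of `mulRound` from `⟨a, ⟨b, ε⟩⟩`. [Arora–Barak 2009, §1.3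
(arithmetic on counters)] [folklore] -/
noncomputable def mulLenFn : List Bool → List Bool :=
  sndP ∘ sndP ∘ (fun z => mulRound^[(X : Polynomial ℕ).eval (boolUnpair z).1.length] z) ∘
    pairFn fstP (pairFn sndP fun _ => [])

/-- **`mulLenFn ∈ FP`.** [Arora–Barak 2009, §1.3, §1.4.1] [folklore] -/
theorem mulLenFn_mem_FP : mulLenFn ∈ FP :=
  comp_mem_FP sndP_mem_FP (comp_mem_FP sndP_mem_FP (comp_mem_FP
    (iterate_mem_FP_of_sq mulRound_mem_FP 4 length_iterate_mulRound_le X)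
    (pairFn_mem_FP fstP_mem_FP (pairFn_mem_FP sndP_mem_FP (const_mem_FP [])))))

/-- `mulLenFn ⟨a, b⟩ = b^{|a|}`. [folklore] -/
theorem mulLenFn_boolPair (a b : List Bool) :
    mulLenFn (boolPair a b) = (List.replicate a.length b).flatten := by
  simp [mulLenFn, iterate_mulRound_boolPair, repApp]

/-- **`|mulLenFn ⟨a, b⟩| = |a|·|b|`.** [folklore] -/
@[simp] theorem length_mulLenFn (a b : List Bool) : (mulLenFn (boolPair a b)).length = a.length * b.length := by
  rw [mulLenFn_boolPair, List.length_flatten]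
  simp

/-! ### Zero pads and zero-padded windows -/

/-- **The zero pad** `zerosPadFn q z = 0^{q(|z.1|)}`: the unary pad `padFn q` zeroed by
`Kannan.zerosFn`. [Arora–Barak 2009, §1.3, §3.1 (polynomials are time-constructible)] [folklore] -/
noncomputable def zerosPadFn (q : Polynomial ℕ) : List Bool → List Bool := Kannan.zerosFn ∘ padFn q

/-- Semantics of the zero pad. [folklore] -/
theorem zerosPadFn_apply (q : Polynomial ℕ) (z : List Bool) :
    zerosPadFn q z = List.replicate (q.eval (boolUnpair z).1.length) false := by
  simp [zerosPadFn, padFn_apply]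

/-- `zerosPadFn q ∈ FP`. [folklore] -/
theorem zerosPadFn_mem_FP (q : Polynomial ℕ) : zerosPadFn q ∈ FP :=
  comp_mem_FP Kannan.zerosFn_mem_FP (padFn_mem_FP q)

/-- The zero-padded window of length `L` of `s` at offset `o`. [folklore] -/
def window (s : List Bool) (o L : ℕ) : List Bool := (s.drop o ++ List.replicate L false).take L

/-- A window has the requested length. [folklore] -/
@[simp] theorem length_window (s : List Bool) (o L : ℕ) : (window s o L).length = L := by
  simp [window]

/-- **Windows read bits with default `0`**: `window s o L = [s.getD o 0, …, s.getD (o + L - 1) 0]`.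
[folklore] -/
theorem window_eq_ofFn (s : List Bool) (o L : ℕ) :
    window s o L = List.ofFn fun c : Fin L => s.getD (o + c) false := by
  apply List.ext_getElem
  · simp
  · intro i h1 h2
    rw [length_window] at h1
    simp only [window, List.getElem_take, List.getElem_ofFn, List.getD_eq_getElem?_getD]
    by_cases hi : i < (s.drop o).length
    · rw [List.getElem_append_left hi, List.getElem_drop, List.getElem?_eq_getElem]
      rfl
    · rw [not_lt] at hi
      rw [List.getElem_append_right hi, List.getElem_replicate]
      rw [List.length_drop] at hi
      rw [List.getElem?_eq_none (by omega)]
      rfl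

/-- The bits of a window. [folklore] -/
theorem getD_window (s : List Bool) (o L : ℕ) {c : ℕ} (hc : c < L) :
    (window s o L).getD c false = s.getD (o + c) false := by
  rw [window_eq_ofFn, List.getD_eq_getElem?_getD, List.getElem?_ofFn]
  simp [hc]

/-- **The window map** `windowFn q ⟨⟨s, o⟩, x⟩ = window s |o| (q |x|)`: drop `|o|` symbols
(`dropSndFn X` on `⟨o, s⟩`), append the zero pad, truncate (`truncSndFn q` on `⟨x, ·⟩`).
[Arora–Barak 2009, §1.3] [folklore] -/
noncomputable def windowFn (q : Polynomial ℕ) : List Bool → List Bool :=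
  sndP ∘ truncSndFn q ∘
    pairFn sndP (concatFn ∘ pairFn (sndP ∘ dropSndFn X ∘ pairFn (sndP ∘ fstP) (fstP ∘ fstP))
      (zerosPadFn q ∘ pairFn sndP fstP))

/-- **`windowFn q ∈ FP`.** [Arora–Barak 2009, §1.3] [folklore] -/
theorem windowFn_mem_FP (q : Polynomial ℕ) : windowFn q ∈ FP :=
  comp_mem_FP sndP_mem_FP (comp_mem_FP (truncSndFn_mem_FP q)
    (pairFn_mem_FP sndP_mem_FP (comp_mem_FP concatFn_mem_FP (pairFn_mem_FP
      (comp_mem_FP sndP_mem_FP (comp_mem_FP (dropSndFn_mem_FP X)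
        (pairFn_mem_FP (comp_mem_FP sndP_mem_FP fstP_mem_FP) (comp_mem_FP fstP_mem_FP fstP_mem_FP))))
      (comp_mem_FP (zerosPadFn_mem_FP q) (pairFn_mem_FP sndP_mem_FP fstP_mem_FP))))))

/-- **Semantics of the window map.** [folklore] -/
theorem windowFn_apply (q : Polynomial ℕ) (s o x : List Bool) :
    windowFn q (boolPair (boolPair s o) x) = window s o.length (q.eval x.length) := by
  simp [windowFn, window, concatFn, concatT_eval_boolPair, dropSndFn_boolPair, truncSndFn_boolPair,
    zerosPadFn_apply]

/-! ### Bits at a unary position -/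

/-- **Reading a bit with `Kannan.bitFn` and `HeadIs 1`**: `bitFn f g w ∈ HeadIs 1 ↔`
`(g w).getD |f w| 0 = 1` (`Kannan.bitFn_apply`, `Kannan.head?_drop_eq_some_true_iff`). [folklore] -/
theorem bitFn_mem_HeadIs_true_iff (f g : List Bool → List Bool) (w : List Bool) :
    Kannan.bitFn f g w ∈ HeadIs true ↔ (g w).getD (f w).length false = true := by
  rw [Kannan.bitFn_apply, mem_HeadIs, Kannan.head?_drop_eq_some_true_iff]

end UnaryOffsets

end Literature.Computability.Complexity
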